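import Literature.AlgebraicGeometry.Resolution.QuasiProjectiveResolution
import Summits.ResolutionOfSingularities.ResolutionOfSingularities.Theses.WeightedInvariant

/-!
# Reshape sketch (lead c4, NOT registered): F″ ⟸ G1 + F‴

`stub_oneRootStepCoreNormal` (F″, the one open stub of line root-of-a-constant) follows from
* G1 `radicialPushdown` — TRUE (paper proof in PICKED.md §delta (1)): a resolution `Z′ → X ⊗_k K` pushes down to a
  proper birational normal model `Y → X` with `Y ⊗_k K` integral and `Z′ → Y ⊗_k K` finite birational
  (`Y := (|Z′|, 𝒪_{Z′} ∩ K(X))`, i.e. the normalisation of `Z′^{(p)} ×_{X^{(p)}} X` in `Spec K(X)`);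
* F‴ `regularTopDescent` — the sharpened residual (open from dim 4 = Picover's radicial bottom with REGULAR top and
  constant coefficient): `X` normal integral, `X ⊗_k K` integral and dominated finitely-birationally by a REGULAR `W`
  ⟹ `HasResolution X`.
The composition below is kernel-checked; the two statements are `sorry`.  This file is evidence only.
-/

noncomputable section

set_option linter.dupNamespace false

open CategoryTheory CategoryTheory.Limits AlgebraicGeometry
open Literature.AlgebraicGeometry.Resolution

namespace Summit.ResolutionOfSingularities.ResolutionOfSingularities.Cruxes.DescentPerfectToAll.Lines.RootOfAConstant.C4

/-- G1 (radicial push-down of a modification; TRUE, not yet formalised): for `a ∈ k ∖ k^p`, `K = k(α)`, `α^p = a`,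
`X` normal integral separated of finite type over `k` with `X ⊗_k K` integral, every resolution of `X ⊗_k K` is,
up to a finite birational map, the `K`-base-change of a proper birational NORMAL model `Y → X`. [folklore] -/
theorem radicialPushdown : ∀ (p : ℕ) [Fact p.Prime] (k K : Type) [Field k] [Field K] [Algebra k K] [CharP k p]
    (a : k) (α : K), (∀ b : k, b ^ p ≠ a) → α ^ p = algebraMap k K a → IntermediateField.adjoin k {α} = ⊤ →
    ∀ (X : Scheme.{0}) (f : X ⟶ Spec (.of k)), IsSeparated f → LocallyOfFiniteType f → QuasiCompact f →
    IsIntegral X → (∀ x : X, IsIntegrallyClosed (X.presheaf.stalk x)) →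
    IsIntegral (pullback f (Spec.map (CommRingCat.ofHom (algebraMap k K)))) →
    Scheme.HasResolution (pullback f (Spec.map (CommRingCat.ofHom (algebraMap k K)))) →
    ∃ (Y : Scheme.{0}) (ρ : Y ⟶ X), IsProper ρ ∧ IsBirational ρ ∧ IsIntegral Y ∧
      (∀ y : Y, IsIntegrallyClosed (Y.presheaf.stalk y)) ∧
      IsIntegral (pullback (ρ ≫ f) (Spec.map (CommRingCat.ofHom (algebraMap k K)))) ∧
      ∃ (W : Scheme.{0}) (ν : W ⟶ pullback (ρ ≫ f) (Spec.map (CommRingCat.ofHom (algebraMap k K)))),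
        IsIntegral W ∧ IsFinite ν ∧ IsBirational ν ∧ Scheme.IsRegular W := by
  sorry

/-- F‴ (the sharpened residual of the crux; OPEN from `dim X = 4`): given resolution over all perfect fields of
characteristic `p`, a normal integral `X/k` whose `K`-base-change (`K = k(a^{1/p})`, integral) is dominated
finitely and birationally by a REGULAR scheme has a resolution.  Summit-implied; crux-complete given G1 and the landed
reductions p106869/p114387/p112741. -/
theorem regularTopDescent : ∀ (p : ℕ) [Fact p.Prime], (∀ (κ : Type) [Field κ] [CharP κ p] [PerfectField κ]
    (Z : Scheme.{0}) (h : Z ⟶ Spec (.of κ)), IsSeparated h → LocallyOfFiniteType h → QuasiCompact h → IsReduced Z →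
    Scheme.HasResolution Z) →
    ∀ (k K : Type) [Field k] [Field K] [Algebra k K] [CharP k p] (a : k) (α : K), (∀ b : k, b ^ p ≠ a) →
    α ^ p = algebraMap k K a → IntermediateField.adjoin k {α} = ⊤ →
    ∀ (X : Scheme.{0}) (f : X ⟶ Spec (.of k)), IsSeparated f → LocallyOfFiniteType f → QuasiCompact f →
    IsIntegral X → (∀ x : X, IsIntegrallyClosed (X.presheaf.stalk x)) →
    IsIntegral (pullback f (Spec.map (CommRingCat.ofHom (algebraMap k K)))) →
    (∃ (W : Scheme.{0}) (ν : W ⟶ pullback f (Spec.map (CommRingCat.ofHom (algebraMap k K)))),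
        IsIntegral W ∧ IsFinite ν ∧ IsBirational ν ∧ Scheme.IsRegular W) →
    Scheme.HasResolution X := by
  sorry

/-- Composition (kernel-checked): G1 + F‴ give F″ = `stub_oneRootStepCoreNormal` verbatim. [folklore] -/
theorem oneRootStepCoreNormal_of : ∀ (p : ℕ) [Fact p.Prime], (∀ (κ : Type) [Field κ] [CharP κ p] [PerfectField κ] (Z : Scheme.{0}) (h : Z ⟶ Spec (.of κ)), IsSeparated h → LocallyOfFiniteType h → QuasiCompact h → IsReduced Z → Scheme.HasResolution Z) → (∀ (k K : Type) [Field k] [Field K] [Algebra k K] [CharP k p] (a : k) (α : K), (∀ b : k, b ^ p ≠ a) → α ^ p = algebraMap k K a → IntermediateField.adjoin k {α} = ⊤ → ∀ (X : Scheme.{0}) (f : X ⟶ Spec (.of k)), IsSeparated f → LocallyOfFiniteType f → QuasiCompact f → IsIntegral X → (∀ x : X, IsIntegrallyClosed (X.presheaf.stalk x)) → IsIntegral (pullback f (Spec.map (CommRingCat.ofHom (algebraMap k K)))) → Scheme.HasResolution (pullback f (Spec.map (CommRingCat.ofHom (algebraMap k K)))) → Scheme.HasResolution X) := by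
  intro p _ H k K _ _ _ _ a α ha hα htop X f hsep hlft hqc hint hnorm hintK hresK
  obtain ⟨Y, ρ, hρ, hbir, hY, hYnorm, hYK, hW⟩ :=
    radicialPushdown p k K a α ha hα htop X f hsep hlft hqc hint hnorm hintK hresK
  haveI := hρ
  have hYres : Scheme.HasResolution Y :=
    regularTopDescent p H k K a α ha hα htop Y (ρ ≫ f) inferInstance inferInstance inferInstance hY hYnorm hYK hW
  exact Scheme.HasResolution.of_isBirational ρ hbir hYres

end Summit.ResolutionOfSingularities.ResolutionOfSingularities.Cruxes.DescentPerfectToAll.Lines.RootOfAConstant.C4
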